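import Summits.NavierStokesRegularity.FluidComputer.CirculationLedger

/-!
# ColliderRelay — the per-generation level ratio of a circulation-conserving relay is
# (shape contrast) × (circulation retention)   (FLUID COMPUTER cell, idea-1 gen 9, P-G9-2)

HONEST FRAMING: low prior, high value-of-information experiment on Tao's machine paradigm;
NOT a claim that NS blows up.

Dictionary (cell files `PREREG-R2.md` §10r, `atlas/IDEA-1.md` §13).  `CirculationLedger` (tree) bounds the
level Reynolds numbers of an amplitude cascade by the PRODUCT of the surviving circulation fractions
(`levelRe_le_prod`) from the one-sided Biot–Savart shape bound `U n ≤ C k_n Γ_n`; it cannot bound a single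
step, because nothing there prevents the in-level band from being incoherent (`U n` far below its shape
bound).  A COLLIDER RELAY (head-on ring collision → reconnection into ringlets → re-aimed head-on
collisions of the ringlets, Lim–Nickels 1992 / McKeown et al. arXiv:1908.01804) delivers to each
generation a COHERENT tube: its band sup-speed achieves at least a fraction of the shape bound,
`c k_n Γ_n ≤ U n` (hypothesis `hcoh`, stated per level, never asserted here).  Then, per step,

* **`reGain_le_retention`** : `r_n = Re_{n+1}/Re_n ≤ (C/c) · s_n` — the rung's level ratio of one
  generation is at most the SHAPE CONTRAST `C/c ≥ 1` times the CIRCULATION RETENTION `s_n ≤ 1`;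
* **`retention_ge_of_floor_step`** : a step at the Navier–Stokes floor `r_n ≥ 1` forces
  `s_n ≥ c/C` — through a reconnection that sheds the fraction `1 - s` of the circulation into
  threads/bridges (≈ 25 % per secondary filament in McKeown et al.), the floor survives only if the
  daughter is MORE speed-efficient per unit circulation than the parent by the factor `1/s`;
* **`two_steps_floor`** : K-R3-2's consecutive-level pass (`r_n ≥ 1` and `r_{n+1} ≥ 1`) forces the
  retention floor at BOTH generations.

Reading for the cell (prose): with shape contrast ≈ 1 (ring → ringlet of similar slenderness) the
level ratio of a collider generation IS its circulation retention — calib1's measured `r₂ = 0.695`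
sits at a reconnection's retention — and the designed iterated collider of P-G9-2 is predicted to
post `r₂ ∈ [0.6, 0.9]`, i.e. to approach the floor from below without reaching it; `r ≥ 1` per
generation needs circulation CONCENTRATION (merger), which a collider does not do.
0 sorry; elementary real algebra over the tree's `CirculationLedger.Ledger`.
Staged by planner seat pub-fluidc-idea-1 gen 9 (HOME/pub-fluidc-idea-1/lean/ColliderRelay.lean);
intended home `Summits/NavierStokesRegularity/FluidComputer/ColliderRelay.lean` (filing is the
literature seat's call).
-/

noncomputable section

namespace Summit.NavierStokesRegularity.FluidComputer.CirculationLedger.Ledger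

variable {L : Ledger}

/-- A coherent in-level tube turns the one-sided ledger into a per-step bound:
`Re_{n+1}/Re_n ≤ (C/c) · s_n`. -/
theorem reGain_le_retention (h : L.Admissible) {c : ℝ} (hc : 0 < c) (n : ℕ)
    (hcoh : c * L.k n * L.Γ n ≤ L.U n) (hU : 0 < L.U n) :
    L.reGain n ≤ L.C / c * L.s n := by
  have hkn := k_pos h n
  have hν := h.ν_pos
  have hRe : 0 < L.levelRe n := div_pos hU (mul_pos hν hkn)
  unfold reGain
  rw [div_le_iff₀ hRe]
  have h1 : L.levelRe (n + 1) ≤ L.C / L.ν * (L.s n * L.Γ n) := levelRe_succ_le h n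
  have h3 : c * L.Γ n / L.ν ≤ L.levelRe n := by
    unfold levelRe
    rw [div_le_div_iff₀ hν (mul_pos hν hkn)]
    calc c * L.Γ n * (L.ν * L.k n) = (c * L.k n * L.Γ n) * L.ν := by ring
      _ ≤ L.U n * L.ν := mul_le_mul_of_nonneg_right hcoh hν.le
  have h2 : L.C / L.ν * (L.s n * L.Γ n) ≤ L.C / c * L.s n * L.levelRe n := by
    calc L.C / L.ν * (L.s n * L.Γ n) = L.C / c * L.s n * (c * L.Γ n / L.ν) := by
          field_simp
      _ ≤ L.C / c * L.s n * L.levelRe n :=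
          mul_le_mul_of_nonneg_left h3 (mul_nonneg (div_nonneg h.C_pos.le hc.le) (h.s_nonneg n))
  exact h1.trans h2

/-- **A floor step forces a retention floor**: `r_n ≥ 1` with a coherent in-level tube gives
`s_n ≥ c/C`. -/
theorem retention_ge_of_floor_step (h : L.Admissible) {c : ℝ} (hc : 0 < c) (n : ℕ)
    (hcoh : c * L.k n * L.Γ n ≤ L.U n) (hU : 0 < L.U n) (hr : 1 ≤ L.reGain n) :
    c / L.C ≤ L.s n := by
  have hb := hr.trans (reGain_le_retention h hc n hcoh hU)
  have h4 : c * 1 ≤ c * (L.C / c * L.s n) := mul_le_mul_of_nonneg_left hb hc.le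
  have h5 : c * (L.C / c * L.s n) = L.C * L.s n := by
    field_simp
  rw [div_le_iff₀ h.C_pos]
  linarith [h4, h5]

/-- **K-R3-2 through a collider**: two consecutive floor steps with coherent in-level tubes force the
retention floor `s ≥ c/C` at both generations. -/
theorem two_steps_floor (h : L.Admissible) {c : ℝ} (hc : 0 < c) (n : ℕ)
    (hcoh₀ : c * L.k n * L.Γ n ≤ L.U n) (hU₀ : 0 < L.U n)
    (hcoh₁ : c * L.k (n + 1) * L.Γ (n + 1) ≤ L.U (n + 1)) (hU₁ : 0 < L.U (n + 1))
    (hr₀ : 1 ≤ L.reGain n) (hr₁ : 1 ≤ L.reGain (n + 1)) :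
    c / L.C ≤ L.s n ∧ c / L.C ≤ L.s (n + 1) :=
  ⟨retention_ge_of_floor_step h hc n hcoh₀ hU₀ hr₀,
   retention_ge_of_floor_step h hc (n + 1) hcoh₁ hU₁ hr₁⟩

/-- Contrapositive in the cell's numbers: if a generation retains at most the fraction `s_n < c/C`
(e.g. `s ≤ 3/4` with shape contrast `C/c < 4/3`), that step is strictly below the floor. -/
theorem reGain_lt_one_of_split (h : L.Admissible) {c : ℝ} (hc : 0 < c) (n : ℕ)
    (hcoh : c * L.k n * L.Γ n ≤ L.U n) (hU : 0 < L.U n) (hs : L.s n < c / L.C) :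
    L.reGain n < 1 := by
  by_contra hr
  exact absurd (retention_ge_of_floor_step h hc n hcoh hU (not_lt.mp hr)) (not_le.mpr hs)

end Summit.NavierStokesRegularity.FluidComputer.CirculationLedger.Ledger
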